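import Literature.Probability.FitznerVanDerHofstad2017.SrwTwistCosPowRow
import HarnessLib

/-!
# The `D̂^{sin}` slices as pure product cosine-power twisted moments

`SrwTwistCosPowRow` reduces the `D̂^l`-weighted twisted moments `Tw^{D̂^l}_n(x;β)`
(Fitzner–van der Hofstad, *NoBLE* (3.34)–(3.38), §5.1.1) to finite averages of PRODUCT cosine-power
twisted moments `Tw^{Π_μ cos^{a_μ}}_n(x;β)`, and gives the `u`-representations of the
`D̂^l D̂^{sin}`- and `D̂^l (D̂^{sin})²`-weighted moments with `sin²`-inserted factor rows.  This file
performs the `sin²` eliminations at the level of the WEIGHTS (`Π_μ cos^{a_μ}·sin²(k_j) =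
Π_μ cos^{a_μ} − Π_μ cos^{a_μ+2[μ=j]}`), so that EVERY weighted slice of the `|D̂|^l`, `|D̂|^l D̂^{sin}`,
`|D̂|^l M̂²` consumer interface is an explicit signed rational combination of PURE product cosine-power
twisted moments — to each of which the product row-truncation theorem
`abs_srwTwist_prodCosPow_sub_rowTrunc_le_sum_srwI` (`SrwTwistCosPowRow`) and the product coefficient
perturbation (`SrwTwistProductRowPerturbation`) apply verbatim:

* `prod_cos_pow_mul_sin_sq_eq_sub`, `srwTwist_sub_weight` (bounded measurable weights);
* `srwTwist_Dhat_pow_mul_Dsin_eq_sum_srwTwist_prodCosPow` —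
  `Tw^{D̂^l D̂^{sin}}_n = d^{-l} d^{-2} Σ_j Σ_p (Tw^{Π cos^{a(p)}}_n − Tw^{Π cos^{a(p)+2e_j}}_n)`;
* `srwTwist_Dhat_pow_mul_Dsin_sq_eq_sum_srwTwist_prodCosPow` — the four-term version for `(D̂^{sin})²`;
* `srwTwist_Dhat_pow_mul_Mhat_sq_eq` — `Tw^{D̂^l M̂²}_n = Tw^{D̂^{l+2}}_n − 4 Tw^{D̂^{l+1}D̂^{sin}}_{n+1}
  + 4 Tw^{D̂^l (D̂^{sin})²}_{n+2}` (`d ≥ 2n+5`), and the `|D̂|^l` forms for even `l`.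

Everything is PROVED (standard axioms), `d`-generic and number-free; no definition, no named fact.
Epistemic status / lane: what-if / input-certification SUPPORT; nothing here is a certificate; no
statement at a specific dimension.

## References
* R. Fitzner, R. van der Hofstad, PTRF 169 (2017) 1041–1119, §3.3.3 p. 1070, (3.34)–(3.38) p. 1071,
  §5.1.1 (5.2)–(5.5), §5.2 (5.9), (5.14) p. 1092. [FitznerVanDerHofstad2016NoBLE]
-/

noncomputable section

open MeasureTheory Set Filter Real
open scoped Topology Nat

namespace Literature.Probability.FitznerVanDerHofstad2017

open Literature.Barriers.CriticalPhenomena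

variable {d : ℕ}

/-! ### `sin²` insertions as differences of cosine powers -/

/-- `Π_μ cos^{a_μ}(k_μ) · sin²(k_j) = Π_μ cos^{a_μ}(k_μ) − Π_μ cos^{a_μ + 2[μ=j]}(k_μ)`.
[cite: FitznerVanDerHofstad2016NoBLE, §3.3.3 p. 1070, (3.34)–(3.38) p. 1071] -/
theorem prod_cos_pow_mul_sin_sq_eq_sub (a : Fin d → ℕ) (j : Fin d) (k : Fin d → ℝ) :
    (∏ μ, Real.cos (k μ) ^ a μ) * Real.sin (k j) ^ 2
      = ∏ μ, Real.cos (k μ) ^ a μ - ∏ μ, Real.cos (k μ) ^ (a μ + if μ = j then 2 else 0) := by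
  have h : ∀ μ : Fin d, Real.cos (k μ) ^ (a μ + if μ = j then 2 else 0)
      = Real.cos (k μ) ^ a μ * (if μ = j then Real.cos (k μ) ^ 2 else 1) := by
    intro μ
    split_ifs <;> simp [pow_add]
  simp_rw [h]
  rw [Finset.prod_mul_distrib, Finset.prod_ite_eq']
  simp only [Finset.mem_univ, if_true, Real.sin_sq]
  ring

/-- The product weights are bounded by `1` in absolute value. [folklore] -/
private theorem abs_prod_cos_pow_le_one (a : Fin d → ℕ) (k : Fin d → ℝ) :
    |∏ μ, Real.cos (k μ) ^ a μ| ≤ 1 := by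
  rw [Finset.abs_prod]
  exact Finset.prod_le_one (fun _ _ => abs_nonneg _) fun μ _ => by
    rw [abs_pow]; exact pow_le_one₀ (abs_nonneg _) (abs_cos_le_one _)

/-- `Tw^{w₁ − w₂}_n = Tw^{w₁}_n − Tw^{w₂}_n` for bounded measurable weights (`d ≥ 2n+1`).
[cite: FitznerVanDerHofstad2016NoBLE, (3.34) p. 1071] -/
theorem srwTwist_sub_weight {n : ℕ} (hd : 2 * n + 1 ≤ d) (w₁ w₂ : (Fin d → ℝ) → ℝ)
    (h₁ : Measurable w₁) (h₂ : Measurable w₂) {W₁ W₂ : ℝ} (hb₁ : ∀ k, |w₁ k| ≤ W₁)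
    (hb₂ : ∀ k, |w₂ k| ≤ W₂) (x : Fin d → ℤ) (β : ℝ) :
    srwTwist d n (fun k => w₁ k - w₂ k) x β = srwTwist d n w₁ x β - srwTwist d n w₂ x β := by
  simp only [srwTwist]
  rw [← sub_div, ← integral_sub (integrable_weight_cos_mul_Chat_pow hd h₁ hb₁ x β)
    (integrable_weight_cos_mul_Chat_pow hd h₂ hb₂ x β)]
  congr 1
  refine integral_congr_ae (ae_of_all _ fun k => ?_)
  ring

/-! ### `D̂^l D̂^{sin}` -/

/-- **`Tw^{D̂^l D̂^{sin}}_n(x;β) = d^{-l} d^{-2} Σ_j Σ_{p : Fin l → Fin d}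
(Tw^{Π_μ cos^{a_μ(p)}}_n(x;β) − Tw^{Π_μ cos^{a_μ(p)+2[μ=j]}}_n(x;β))`** for `d ≥ 2n+1`, every node `x`
and every `β` (`a_μ(p) = #{t : p t = μ}`): the `D̂^l D̂^{sin}`-weighted twisted moment is a signed
rational combination of PURE product cosine-power twisted moments.
[cite: FitznerVanDerHofstad2016NoBLE, §3.3.3 p. 1070, (3.34)–(3.38) p. 1071, §5.1.1 (5.2)–(5.5)] -/
theorem srwTwist_Dhat_pow_mul_Dsin_eq_sum_srwTwist_prodCosPow {n : ℕ} (hd : 2 * n + 1 ≤ d)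
    (x : Fin d → ℤ) (β : ℝ) (l : ℕ) :
    srwTwist d n (fun k => Dhat d k ^ l * Dsin d k) x β
      = ((d : ℝ) ^ l)⁻¹ * (((d : ℝ) ^ 2)⁻¹ * ∑ j : Fin d, ∑ p : Fin l → Fin d,
          (srwTwist d n (fun k => ∏ μ, Real.cos (k μ) ^ (Finset.univ.filter (fun t => p t = μ)).card) x β
            - srwTwist d n (fun k => ∏ μ, Real.cos (k μ)
                ^ ((Finset.univ.filter (fun t => p t = μ)).card + if μ = j then 2 else 0)) x β)) := by
  -- the weight as ONE finite sum over pairs `(j, p)` of scaled differences of product weights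
  have hprod : ∀ (k : Fin d → ℝ) (j : Fin d) (p : Fin l → Fin d),
      ∏ μ, (Real.cos (k μ) ^ (Finset.univ.filter (fun t => p t = μ)).card
        * (if μ = j then Real.sin (k μ) ^ 2 else 1))
      = ∏ μ, Real.cos (k μ) ^ (Finset.univ.filter (fun t => p t = μ)).card
          - ∏ μ, Real.cos (k μ) ^ ((Finset.univ.filter (fun t => p t = μ)).card
              + if μ = j then 2 else 0) := by
    intro k j p
    rw [Finset.prod_mul_distrib, Finset.prod_ite_eq']
    simp only [Finset.mem_univ, if_true]
    exact prod_cos_pow_mul_sin_sq_eq_sub _ j k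
  have hw : (fun k : Fin d → ℝ => Dhat d k ^ l * Dsin d k) = fun k => ∑ x : Fin d × (Fin l → Fin d),
      (((d : ℝ) ^ l)⁻¹ * ((d : ℝ) ^ 2)⁻¹)
        * (∏ μ, Real.cos (k μ) ^ (Finset.univ.filter (fun t => x.2 t = μ)).card
          - ∏ μ, Real.cos (k μ) ^ ((Finset.univ.filter (fun t => x.2 t = μ)).card
              + if μ = x.1 then 2 else 0)) := by
    funext k
    rw [Dhat_pow_mul_Dsin_eq_sum, Fintype.sum_prod_type, ← mul_assoc, Finset.mul_sum]
    simp_rw [Finset.mul_sum, hprod]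
  have hm : ∀ a : Fin d → ℕ, Measurable fun k : Fin d → ℝ => ∏ μ, Real.cos (k μ) ^ a μ :=
    fun a => Finset.measurable_prod _ fun μ _ => by fun_prop
  rw [hw, srwTwist_sum_weight (Finset.univ) (fun _ => ((d : ℝ) ^ l)⁻¹ * ((d : ℝ) ^ 2)⁻¹)
    (fun (x : Fin d × (Fin l → Fin d)) (k : Fin d → ℝ) =>
      ∏ μ, Real.cos (k μ) ^ (Finset.univ.filter (fun t => x.2 t = μ)).card
        - ∏ μ, Real.cos (k μ) ^ ((Finset.univ.filter (fun t => x.2 t = μ)).card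
            + if μ = x.1 then 2 else 0)) hd
    (fun x _ => (hm _).sub (hm _))
    (fun x _ => ⟨1 + 1, fun k => (abs_sub _ _).trans
      (add_le_add (abs_prod_cos_pow_le_one _ k) (abs_prod_cos_pow_le_one _ k))⟩),
    ← Finset.mul_sum, mul_assoc, Fintype.sum_prod_type]
  congr 2
  refine Finset.sum_congr rfl fun j _ => Finset.sum_congr rfl fun p _ => ?_
  try dsimp only
  exact srwTwist_sub_weight hd _ _ (hm _) (hm _) (abs_prod_cos_pow_le_one _)
    (abs_prod_cos_pow_le_one _) x β

/-! ### `D̂^l (D̂^{sin})²` -/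

/-- Two `sin²` insertions: `Π cos^{a}·sin²(k_j)·sin²(k_{j'}) = Π cos^{a} − Π cos^{a+2e_j} − Π cos^{a+2e_{j'}}
+ Π cos^{a+2e_j+2e_{j'}}` (valid also for `j = j'`).
[cite: FitznerVanDerHofstad2016NoBLE, §3.3.3 p. 1070, (3.34)–(3.38) p. 1071] -/
theorem prod_cos_pow_mul_sin_sq_mul_sin_sq_eq (a : Fin d → ℕ) (j j' : Fin d) (k : Fin d → ℝ) :
    (∏ μ, Real.cos (k μ) ^ a μ) * Real.sin (k j) ^ 2 * Real.sin (k j') ^ 2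
      = ∏ μ, Real.cos (k μ) ^ a μ
        - ∏ μ, Real.cos (k μ) ^ (a μ + if μ = j then 2 else 0)
        - ∏ μ, Real.cos (k μ) ^ (a μ + if μ = j' then 2 else 0)
        + ∏ μ, Real.cos (k μ) ^ ((a μ + if μ = j then 2 else 0) + if μ = j' then 2 else 0) := by
  rw [prod_cos_pow_mul_sin_sq_eq_sub a j k, sub_mul,
    prod_cos_pow_mul_sin_sq_eq_sub a j' k,
    prod_cos_pow_mul_sin_sq_eq_sub (fun μ => a μ + if μ = j then 2 else 0) j' k]
  ring

/-- **`Tw^{D̂^l (D̂^{sin})²}_n(x;β) = d^{-l} d^{-2} d^{-2} Σ_j Σ_{j'} Σ_p (Tw^{Π cos^{a(p)}}_n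
− Tw^{Π cos^{a(p)+2e_j}}_n − Tw^{Π cos^{a(p)+2e_{j'}}}_n + Tw^{Π cos^{a(p)+2e_j+2e_{j'}}}_n)`** for
`d ≥ 2n+1`: the `D̂^l (D̂^{sin})²`-weighted twisted moment as a signed rational combination of PURE
product cosine-power twisted moments.
[cite: FitznerVanDerHofstad2016NoBLE, §3.3.3 p. 1070, (3.34)–(3.38) p. 1071, §5.1.1 (5.2)–(5.5), §5.2 (5.9), (5.14) p. 1092] -/
theorem srwTwist_Dhat_pow_mul_Dsin_sq_eq_sum_srwTwist_prodCosPow {n : ℕ} (hd : 2 * n + 1 ≤ d)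
    (x : Fin d → ℤ) (β : ℝ) (l : ℕ) :
    srwTwist d n (fun k => Dhat d k ^ l * Dsin d k ^ 2) x β
      = ((d : ℝ) ^ l)⁻¹ * (((d : ℝ) ^ 2)⁻¹ * (((d : ℝ) ^ 2)⁻¹
        * ∑ j : Fin d, ∑ j' : Fin d, ∑ p : Fin l → Fin d,
          (srwTwist d n (fun k => ∏ μ, Real.cos (k μ) ^ (Finset.univ.filter (fun t => p t = μ)).card) x β
            - srwTwist d n (fun k => ∏ μ, Real.cos (k μ)
                ^ ((Finset.univ.filter (fun t => p t = μ)).card + if μ = j then 2 else 0)) x β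
            - srwTwist d n (fun k => ∏ μ, Real.cos (k μ)
                ^ ((Finset.univ.filter (fun t => p t = μ)).card + if μ = j' then 2 else 0)) x β
            + srwTwist d n (fun k => ∏ μ, Real.cos (k μ)
                ^ (((Finset.univ.filter (fun t => p t = μ)).card + if μ = j then 2 else 0)
                    + if μ = j' then 2 else 0)) x β))) := by
  -- abbreviations for the four product weights attached to `(j, j', p)`
  set A : (Fin l → Fin d) → Fin d → ℕ := fun p μ => (Finset.univ.filter (fun t => p t = μ)).card
    with hA
  have hprod : ∀ (k : Fin d → ℝ) (j j' : Fin d) (p : Fin l → Fin d),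
      ∏ μ, (Real.cos (k μ) ^ A p μ * (if μ = j then Real.sin (k μ) ^ 2 else 1)
        * (if μ = j' then Real.sin (k μ) ^ 2 else 1))
      = ∏ μ, Real.cos (k μ) ^ A p μ
        - ∏ μ, Real.cos (k μ) ^ (A p μ + if μ = j then 2 else 0)
        - ∏ μ, Real.cos (k μ) ^ (A p μ + if μ = j' then 2 else 0)
        + ∏ μ, Real.cos (k μ) ^ ((A p μ + if μ = j then 2 else 0) + if μ = j' then 2 else 0) := by
    intro k j j' p
    rw [Finset.prod_mul_distrib, Finset.prod_mul_distrib, Finset.prod_ite_eq', Finset.prod_ite_eq']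
    simp only [Finset.mem_univ, if_true]
    exact prod_cos_pow_mul_sin_sq_mul_sin_sq_eq _ j j' k
  -- the four-term difference weight attached to `(j, j', p)`
  set w : Fin d × Fin d × (Fin l → Fin d) → (Fin d → ℝ) → ℝ := fun x k =>
      ∏ μ, Real.cos (k μ) ^ A x.2.2 μ
        - ∏ μ, Real.cos (k μ) ^ (A x.2.2 μ + if μ = x.1 then 2 else 0)
        - ∏ μ, Real.cos (k μ) ^ (A x.2.2 μ + if μ = x.2.1 then 2 else 0)
        + ∏ μ, Real.cos (k μ) ^ ((A x.2.2 μ + if μ = x.1 then 2 else 0) + if μ = x.2.1 then 2 else 0)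
    with hwdef
  have hw : (fun k : Fin d → ℝ => Dhat d k ^ l * Dsin d k ^ 2)
      = fun k => ∑ x : Fin d × Fin d × (Fin l → Fin d),
          (((d : ℝ) ^ l)⁻¹ * (((d : ℝ) ^ 2)⁻¹ * ((d : ℝ) ^ 2)⁻¹)) * w x k := by
    funext k
    rw [Dhat_pow_mul_Dsin_sq_eq_sum, Fintype.sum_prod_type]
    simp_rw [Fintype.sum_prod_type, hwdef, ← hprod]
    simp only [← Finset.mul_sum]
    ring
  have hm : ∀ a : Fin d → ℕ, Measurable fun k : Fin d → ℝ => ∏ μ, Real.cos (k μ) ^ a μ :=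
    fun a => Finset.measurable_prod _ fun μ _ => by fun_prop
  have hwm : ∀ x, Measurable (w x) := fun x =>
    (((hm _).sub (hm _)).sub (hm _)).add (hm _)
  have hwb : ∀ x k, |w x k| ≤ 1 + 1 + 1 + 1 := by
    intro x k
    simp only [hwdef]
    refine (abs_add_le _ _).trans (add_le_add ((abs_sub _ _).trans (add_le_add ((abs_sub _ _).trans
      (add_le_add (abs_prod_cos_pow_le_one _ k) (abs_prod_cos_pow_le_one _ k)))
      (abs_prod_cos_pow_le_one _ k))) (abs_prod_cos_pow_le_one _ k))
  rw [hw, srwTwist_sum_weight (Finset.univ) (fun _ => ((d : ℝ) ^ l)⁻¹ * (((d : ℝ) ^ 2)⁻¹ * ((d : ℝ) ^ 2)⁻¹))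
    w hd (fun x _ => hwm x) (fun x _ => ⟨_, hwb x⟩), ← Finset.mul_sum, mul_assoc, mul_assoc,
    Fintype.sum_prod_type]
  simp_rw [Fintype.sum_prod_type]
  congr 3
  refine Finset.sum_congr rfl fun j _ => Finset.sum_congr rfl fun j' _ =>
    Finset.sum_congr rfl fun p _ => ?_
  simp only [hwdef]
  -- split the four-term weight by linearity
  have hb1 : ∀ a : Fin d → ℕ, ∀ k : Fin d → ℝ, |∏ μ, Real.cos (k μ) ^ a μ| ≤ 1 :=
    fun a k => abs_prod_cos_pow_le_one a k
  have s1 := srwTwist_sub_weight hd (fun k => ∏ μ, Real.cos (k μ) ^ A p μ)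
    (fun k => ∏ μ, Real.cos (k μ) ^ (A p μ + if μ = j then 2 else 0)) (hm _) (hm _) (hb1 _) (hb1 _) x β
  have hm12 : Measurable fun k : Fin d → ℝ => ∏ μ, Real.cos (k μ) ^ A p μ
      - ∏ μ, Real.cos (k μ) ^ (A p μ + if μ = j then 2 else 0) := (hm _).sub (hm _)
  have hb12 : ∀ k : Fin d → ℝ, |∏ μ, Real.cos (k μ) ^ A p μ
      - ∏ μ, Real.cos (k μ) ^ (A p μ + if μ = j then 2 else 0)| ≤ 1 + 1 :=
    fun k => (abs_sub _ _).trans (add_le_add (hb1 _ k) (hb1 _ k))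
  have s2 := srwTwist_sub_weight hd
    (fun k => ∏ μ, Real.cos (k μ) ^ A p μ - ∏ μ, Real.cos (k μ) ^ (A p μ + if μ = j then 2 else 0))
    (fun k => ∏ μ, Real.cos (k μ) ^ (A p μ + if μ = j' then 2 else 0)) hm12 (hm _) hb12 (hb1 _) x β
  have hm123 : Measurable fun k : Fin d → ℝ => ∏ μ, Real.cos (k μ) ^ A p μ
      - ∏ μ, Real.cos (k μ) ^ (A p μ + if μ = j then 2 else 0)
      - ∏ μ, Real.cos (k μ) ^ (A p μ + if μ = j' then 2 else 0) := hm12.sub (hm _)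
  have hb123 : ∀ k : Fin d → ℝ, |∏ μ, Real.cos (k μ) ^ A p μ
      - ∏ μ, Real.cos (k μ) ^ (A p μ + if μ = j then 2 else 0)
      - ∏ μ, Real.cos (k μ) ^ (A p μ + if μ = j' then 2 else 0)| ≤ 1 + 1 + 1 :=
    fun k => (abs_sub _ _).trans (add_le_add (hb12 k) (hb1 _ k))
  have hadd : (fun k : Fin d → ℝ => ∏ μ, Real.cos (k μ) ^ A p μ
      - ∏ μ, Real.cos (k μ) ^ (A p μ + if μ = j then 2 else 0)
      - ∏ μ, Real.cos (k μ) ^ (A p μ + if μ = j' then 2 else 0)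
      + ∏ μ, Real.cos (k μ) ^ ((A p μ + if μ = j then 2 else 0) + if μ = j' then 2 else 0))
      = fun k => (∏ μ, Real.cos (k μ) ^ A p μ
      - ∏ μ, Real.cos (k μ) ^ (A p μ + if μ = j then 2 else 0)
      - ∏ μ, Real.cos (k μ) ^ (A p μ + if μ = j' then 2 else 0))
      - (-1) * ∏ μ, Real.cos (k μ) ^ ((A p μ + if μ = j then 2 else 0) + if μ = j' then 2 else 0) := by
    funext k; ring
  have hm4 : Measurable fun k : Fin d → ℝ =>
      (-1) * ∏ μ, Real.cos (k μ) ^ ((A p μ + if μ = j then 2 else 0) + if μ = j' then 2 else 0) :=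
    measurable_const.mul (hm _)
  have hb4 : ∀ k : Fin d → ℝ,
      |(-1) * ∏ μ, Real.cos (k μ) ^ ((A p μ + if μ = j then 2 else 0) + if μ = j' then 2 else 0)| ≤ 1 :=
    fun k => by rw [abs_mul, abs_neg, abs_one, one_mul]; exact hb1 _ k
  have s3 := srwTwist_sub_weight hd _ _ hm123 hm4 hb123 hb4 x β
  rw [hadd, s3, s2, s1, srwTwist_const_mul_weight]
  ring

/-! ### The `M̂²` slices -/

/-- **`Tw^{D̂^l M̂²}_n(x;β) = Tw^{D̂^{l+2}}_n(x;β) − 4 Tw^{D̂^{l+1} D̂^{sin}}_{n+1}(x;β)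
+ 4 Tw^{D̂^l (D̂^{sin})²}_{n+2}(x;β)`** for `d ≥ 2n+5` (`M̂ = D̂ − 2D̂^{sin}Ĉ`): with the three reductions
`srwTwist_Dhat_pow_eq_sum_srwTwist_prodCosPow`, `srwTwist_Dhat_pow_mul_Dsin_eq_sum_srwTwist_prodCosPow`,
`srwTwist_Dhat_pow_mul_Dsin_sq_eq_sum_srwTwist_prodCosPow` every `D̂^l M̂²`-weighted twisted moment is an
explicit signed rational combination of pure product cosine-power twisted moments at Schwinger orders
`n, n+1, n+2`. [cite: FitznerVanDerHofstad2016NoBLE, §3.3.3 p. 1070, (3.34)–(3.38) p. 1071, §5.2 (5.9), (5.14) p. 1092] -/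
theorem srwTwist_Dhat_pow_mul_Mhat_sq_eq {n : ℕ} (hd : 2 * (n + 2) + 1 ≤ d) (x : Fin d → ℤ) (β : ℝ)
    (l : ℕ) :
    srwTwist d n (fun k => Dhat d k ^ l * Mhat d k ^ 2) x β
      = srwTwist d n (fun k => Dhat d k ^ (l + 2)) x β
        - 4 * srwTwist d (n + 1) (fun k => Dhat d k ^ (l + 1) * Dsin d k) x β
        + 4 * srwTwist d (n + 2) (fun k => Dhat d k ^ l * Dsin d k ^ 2) x β := by
  have h := srwTwist_weight_mul_Mhat_sq_eq hd (w := fun k => Dhat d k ^ l)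
    ((continuous_Dhat d).measurable.pow_const l)
    (fun k => by rw [abs_pow]; exact pow_le_one₀ (abs_nonneg _) (abs_Dhat_le_one k)) x β
  rw [h]
  have e1 : (fun k : Fin d → ℝ => Dhat d k ^ l * Dhat d k ^ 2) = fun k => Dhat d k ^ (l + 2) := by
    funext k; rw [pow_add]
  have e2 : (fun k : Fin d → ℝ => Dhat d k ^ l * Dhat d k * Dsin d k)
      = fun k => Dhat d k ^ (l + 1) * Dsin d k := by
    funext k; rw [pow_succ]
  rw [e1, e2]

/-- For even `l`: `Tw^{|D̂|^l M̂²}_n = Tw^{D̂^{l+2}}_n − 4 Tw^{D̂^{l+1}D̂^{sin}}_{n+1} + 4 Tw^{D̂^l(D̂^{sin})²}_{n+2}`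
(`d ≥ 2n+5`) — the `KM₂` weights of the consumer interface.
[cite: FitznerVanDerHofstad2016NoBLE, §3.3.3 p. 1070, (3.34)–(3.38) p. 1071, §5.2 (5.9), (5.14) p. 1092] -/
theorem srwTwist_abs_Dhat_pow_mul_Mhat_sq_eq_of_even {n : ℕ} (hd : 2 * (n + 2) + 1 ≤ d)
    (x : Fin d → ℤ) (β : ℝ) {l : ℕ} (hl : Even l) :
    srwTwist d n (fun k => |Dhat d k| ^ l * Mhat d k ^ 2) x β
      = srwTwist d n (fun k => Dhat d k ^ (l + 2)) x β
        - 4 * srwTwist d (n + 1) (fun k => Dhat d k ^ (l + 1) * Dsin d k) x β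
        + 4 * srwTwist d (n + 2) (fun k => Dhat d k ^ l * Dsin d k ^ 2) x β := by
  have hw : (fun k : Fin d → ℝ => |Dhat d k| ^ l * Mhat d k ^ 2) = fun k => Dhat d k ^ l * Mhat d k ^ 2 := by
    funext k; rw [hl.pow_abs]
  rw [hw]
  exact srwTwist_Dhat_pow_mul_Mhat_sq_eq hd x β l

/-- For even `l`: `Tw^{|D̂|^l D̂^{sin}}_n = d^{-l}d^{-2} Σ_j Σ_p (Tw^{Π cos^{a(p)}}_n − Tw^{Π cos^{a(p)+2e_j}}_n)`
(`d ≥ 2n+1`). [cite: FitznerVanDerHofstad2016NoBLE, §3.3.3 p. 1070, (3.34)–(3.38) p. 1071] -/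
theorem srwTwist_abs_Dhat_pow_mul_Dsin_eq_sum_srwTwist_prodCosPow_of_even {n : ℕ} (hd : 2 * n + 1 ≤ d)
    (x : Fin d → ℤ) (β : ℝ) {l : ℕ} (hl : Even l) :
    srwTwist d n (fun k => |Dhat d k| ^ l * Dsin d k) x β
      = ((d : ℝ) ^ l)⁻¹ * (((d : ℝ) ^ 2)⁻¹ * ∑ j : Fin d, ∑ p : Fin l → Fin d,
          (srwTwist d n (fun k => ∏ μ, Real.cos (k μ) ^ (Finset.univ.filter (fun t => p t = μ)).card) x β
            - srwTwist d n (fun k => ∏ μ, Real.cos (k μ)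
                ^ ((Finset.univ.filter (fun t => p t = μ)).card + if μ = j then 2 else 0)) x β)) := by
  have hw : (fun k : Fin d → ℝ => |Dhat d k| ^ l * Dsin d k) = fun k => Dhat d k ^ l * Dsin d k := by
    funext k; rw [hl.pow_abs]
  rw [hw]
  exact srwTwist_Dhat_pow_mul_Dsin_eq_sum_srwTwist_prodCosPow hd x β l

/-- For even `l`: the `|D̂|^l (D̂^{sin})²`-weighted twisted moment (`U`-type rows at Schwinger order `n+2` of the
`KM₂` insertion) is the same four-term signed rational combination of pure product cosine-power twisted moments
(`d ≥ 2n+1`). [cite: FitznerVanDerHofstad2016NoBLE, §3.3.3 p. 1070, (3.34)–(3.38) p. 1071, §5.2 (5.9), (5.14) p. 1092] -/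
theorem srwTwist_abs_Dhat_pow_mul_Dsin_sq_eq_sum_srwTwist_prodCosPow_of_even {n : ℕ} (hd : 2 * n + 1 ≤ d)
    (x : Fin d → ℤ) (β : ℝ) {l : ℕ} (hl : Even l) :
    srwTwist d n (fun k => |Dhat d k| ^ l * Dsin d k ^ 2) x β
      = ((d : ℝ) ^ l)⁻¹ * (((d : ℝ) ^ 2)⁻¹ * (((d : ℝ) ^ 2)⁻¹
        * ∑ j : Fin d, ∑ j' : Fin d, ∑ p : Fin l → Fin d,
          (srwTwist d n (fun k => ∏ μ, Real.cos (k μ) ^ (Finset.univ.filter (fun t => p t = μ)).card) x β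
            - srwTwist d n (fun k => ∏ μ, Real.cos (k μ)
                ^ ((Finset.univ.filter (fun t => p t = μ)).card + if μ = j then 2 else 0)) x β
            - srwTwist d n (fun k => ∏ μ, Real.cos (k μ)
                ^ ((Finset.univ.filter (fun t => p t = μ)).card + if μ = j' then 2 else 0)) x β
            + srwTwist d n (fun k => ∏ μ, Real.cos (k μ)
                ^ (((Finset.univ.filter (fun t => p t = μ)).card + if μ = j then 2 else 0)
                    + if μ = j' then 2 else 0)) x β))) := by
  have hw : (fun k : Fin d → ℝ => |Dhat d k| ^ l * Dsin d k ^ 2) = fun k => Dhat d k ^ l * Dsin d k ^ 2 := by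
    funext k; rw [hl.pow_abs]
  rw [hw]
  exact srwTwist_Dhat_pow_mul_Dsin_sq_eq_sum_srwTwist_prodCosPow hd x β l

/-- The multiplicities are bounded: `a_μ(p) + 2[μ=j] + 2[μ=j'] ≤ l + 4` — the `amax` to feed to the
product row-truncation theorem (bookkeeping). [cite: FitznerVanDerHofstad2016NoBLE, §5.1.1 (5.2)–(5.5)] -/
theorem card_filter_add_indicator_le (l : ℕ) (p : Fin l → Fin d) (μ j j' : Fin d) :
    ((Finset.univ.filter (fun t => p t = μ)).card + (if μ = j then 2 else 0)) + (if μ = j' then 2 else 0)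
      ≤ l + 4 := by
  have h1 : (Finset.univ.filter (fun t => p t = μ)).card ≤ l :=
    (Finset.card_filter_le _ _).trans (by simp)
  have h2 : (if μ = j then 2 else 0) ≤ 2 := by split_ifs <;> omega
  have h3 : (if μ = j' then 2 else 0) ≤ 2 := by split_ifs <;> omega
  omega

end Literature.Probability.FitznerVanDerHofstad2017
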